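import Summits.CriticalPhenomena.Ising3DConformalLimit.Theses.ReflectionTwin
import Summits.CriticalPhenomena.Ising3DConformalLimit.Theorems.HyperoctahedralRPLimitRotationInvariant
import Summits.CriticalPhenomena.Ising3DConformalLimit.Theorems.HyperoctahedralRPHRP2Rigidity
import Summits.CriticalPhenomena.Ising3DConformalLimit.Theorems.MoebiusLimitExists.Negative.ScaleRedundant
import Summits.CriticalPhenomena.Ising3DConformalLimit.Theorems.MoebiusLimitExists.Negative.FreeTranslations
import Literature.Probability.LatticeModels.TwistCorrBoxLimit
import HarnessLib

/-!
# Stub `stub_replicaAllUpperUniform` (S5au) of line `replica-mirror` (v4) for crux `ReflectionTwin.TwinTransparency`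
(stmt-CriticalPhenomena-16905)

The REPLICA TWIN of `ℤ³` resamples the lower half-crystal `{h ≤ -1}` (`h z = z₀ + z₁ + z₂`) of a critical
free-box sample given the rest, and pairs OLD spins (points of `w` on/below the plane `x₀ + x₁ + x₂ = 0`, read at
`[wᵢ/δ]`) with NEW spins (points above the plane, reflected by the mirror `θ` of the plane and read in the
resampled configuration):
`replicaBox L k old z = ⟨(∏_{old i} σ_{zᵢ}) · E[∏_{¬ old i} σ'_{zᵢ} | spins off {h ≤ -1}]⟩^∅_{box 3 L; β_c(3)}`,
`replicaFold δ k w = limsup_L replicaBox L k (hw ≤ 0) [fold w / δ]`, `fold v = v` below the plane, `θ v` above.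

`stub_replicaAllUpperUniform` is the ALL-UPPER instance of the replica mirror in LOCALLY UNIFORM form (it upgrades
the pointwise `stub_replicaAllUpper` of `…ReplicaAllUpper.lean`, whose private helpers are copied here under new
names): on `NonCoincident 3 k ∩ {w | ∀ i, 0 < h(wᵢ)}` every point is NEW, the OLD monomial is `1`, and by the tower
property of the exact conditional resampling (`gibbsAvg_condLow_eq_au`) the box average is the free-box bulk
correlator at the reflected sites, `twistCorr L 0 0 0 k [θw/δ] → criticalCorr 3 k [θw/δ]`
(`tendsto_twistCorr_zero_right`, `Tendsto.limsup_eq`); hence for EVERY `δ`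
`ρ(δ)^k · replicaFold δ k w = rescaledCorrelator (criticalCorr 3) ρ k δ (θ ∘ w)` on that set. The datum's locally
uniform convergence on `NonCoincident` is pulled back along the continuous injective map `w ↦ θ ∘ w`
(`TendstoLocallyUniformlyOn.comp`), matched with the replica correlator (`.congr`), and its limit `S k (θ ∘ w)` is
`S k w` (`.congr_right`) because EVERY limit datum with `S₂ > 0` is `O(3)`-invariant on `NonCoincident`
(tree: `MoebiusLimitExistsNegative.{exists_scaleCovariant_normalised, normalised_hasLimit, normalised_nondeg,
isTranslationInvariant_normalised_of_limit}` and `limitRotationInvariant_proof ∘ HRP2Rigidity_of`).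

References: S. Friedli, Y. Velenik, *Statistical Mechanics of Lattice Systems* (CUP 2017), §3.6 and Exercise 3.16
(free-state box limit by GKS), ch. 6 (consistency of the finite-volume Gibbs kernels = the tower property);
M. Aizenman, H. Duminil-Copin, V. Sidoravicius, Comm. Math. Phys. 334 (2015), Thm. 1.2 (free = plus at `β_c`,
`d = 3`). No definitions, no new named facts; four private helpers.
-/

noncomputable section

namespace Summit.CriticalPhenomena.Ising3DConformalLimit.Cruxes.TwinTransparency.ReplicaMirror

open scoped BigOperators Topology Manifold Classical MeasureTheory ProbabilityTheory Matrix InnerProductSpace ComplexConjugate ContinuousMap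
open Filter Set Function TopologicalSpace MeasureTheory
open Literature.Probability.LatticeModels

/-! ## The free-box bulk correlator is the untwisted twisted-box correlator (as in `…ReplicaAllUpper.lean`) -/

/-- The free-box nearest-neighbour critical couplings `β_c(3)/2 · 𝟙{‖a - b‖₁ = 1}` of `ℤ³` (ordered pairs) are
the tree's twist couplings with zero Burgers number, `twistCouplings L 0 0 0` (`twistCouplings_zero_right` and
`x ∼ y ↔ ‖x - y‖₁ = 1`, `zdGraph_adj_iff_norm_holds`). [folklore] -/
private theorem nnCouplings_eq_twistCouplings_au (L : ℕ) :
    (fun a b : ↥(box 3 L) => if (∑ i, |a.1 i - b.1 i| = 1) then criticalBeta 3 / 2 else (0:ℝ)) =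
      twistCouplings L 0 0 0 := by
  funext a b
  rw [twistCouplings_zero_right]
  exact if_congr (zdGraph_adj_iff_norm_holds a.1 b.1).symm rfl rfl

/-- Hence the free-box bulk correlator `⟨∏ᵢ σ_{zᵢ}⟩^∅_{box 3 L; β_c(3)}` (a `PairIsing.gibbsAvg`, with the junk
factor `0` for a site off the box) IS the untwisted twisted-box correlator `twistCorr L 0 0 0 k z` of
`TwistCorr.lean` (`PairIsing.gibbsAvg` and `PairIsing.avg` agree definitionally). [folklore] -/
private theorem gibbsAvg_nn_eq_twistCorr_au (L k : ℕ) (z : Fin k → Site 3) :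
    PairIsing.gibbsAvg (fun a b : ↥(box 3 L) => if (∑ i, |a.1 i - b.1 i| = 1) then criticalBeta 3 / 2 else (0:ℝ))
        (fun s => ∏ i, if h : z i ∈ box 3 L then spinAt (⟨z i, h⟩ : ↥(box 3 L)) s else 0) =
      twistCorr L 0 0 0 k z := by
  rw [nnCouplings_eq_twistCouplings_au]
  rfl

/-! ## Tower property of the exact conditional resampling (as in `…ReplicaAllUpper.lean`) -/

/-- **Class averages integrate to the full sum.** If `C : Ω → Finset Ω` assigns to each point a class containing
it, constant along each class (`s' ∈ C s → C s' = C s`, so the classes partition `Ω` and `s' ∈ C s ↔ s ∈ C s'`),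
then for positive weights `wt` the weighted sum of the class averages `(∑_{C s} g wt) / (∑_{C s} wt)` is the
weighted sum of `g`: swap the double sum over the symmetric relation (`Finset.sum_comm'`). [folklore] -/
private theorem sum_classAvg_mul_eq_au {Ω : Type*} [Fintype Ω] (C : Ω → Finset Ω) (hrefl : ∀ s, s ∈ C s)
    (hcls : ∀ s, ∀ s' ∈ C s, C s' = C s) (wt g : Ω → ℝ) (hwt : ∀ s, 0 < wt s) :
    ∑ s, (∑ s' ∈ C s, g s' * wt s') / (∑ s' ∈ C s, wt s') * wt s = ∑ s, g s * wt s := by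
  have hsymm : ∀ s s', s' ∈ C s ↔ s ∈ C s' := fun s s' =>
    ⟨fun h => by rw [hcls s s' h]; exact hrefl s, fun h => by rw [hcls s' s h]; exact hrefl s'⟩
  calc ∑ s, (∑ s' ∈ C s, g s' * wt s') / (∑ s' ∈ C s, wt s') * wt s
      = ∑ s, ∑ s' ∈ C s, g s' * wt s' * wt s / ∑ t ∈ C s', wt t := by
        refine Finset.sum_congr rfl fun s _ => ?_
        rw [div_mul_eq_mul_div, Finset.sum_mul, Finset.sum_div]
        exact Finset.sum_congr rfl fun s' hs' => by rw [hcls s s' hs']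
    _ = ∑ s', ∑ s ∈ C s', g s' * wt s' * wt s / ∑ t ∈ C s', wt t :=
        Finset.sum_comm' fun s s' =>
          ⟨fun h => ⟨(hsymm s s').1 h.2, Finset.mem_univ _⟩, fun h => ⟨Finset.mem_univ _, (hsymm s s').2 h.1⟩⟩
    _ = ∑ s', g s' * wt s' := by
        refine Finset.sum_congr rfl fun s' _ => ?_
        rw [← Finset.sum_div, ← Finset.mul_sum, mul_div_assoc,
          div_self (Finset.sum_pos (fun t _ => hwt t) ⟨s', hrefl s'⟩).ne', mul_one]

/-- **Tower property of the exact conditional resampling.** For pair couplings `c` on the spins of a finite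
set `ι` and a set of frozen sites `{a | q a}`: averaging `g` over the class `{s' | ∀ a, q a → s' a = s a}` of the
configuration `s` with the Boltzmann weights (the exact conditional expectation `E_c[g | σ_a, q a]` of the
finite-volume Gibbs measure, evaluated at `s`) and then taking the Gibbs average in `s` returns the Gibbs average
of `g`: `⟨E_c[g | σ_a, q a]⟩_c = ⟨g⟩_c` (consistency of the finite-volume Gibbs kernels). [folklore] -/
private theorem gibbsAvg_condLow_eq_au {ι : Type*} [Fintype ι] [DecidableEq ι] (c : ι → ι → ℝ) (q : ι → Prop)
    (g : SpinConfig ι → ℝ) {_ : ∀ s : SpinConfig ι, DecidablePred fun s' : SpinConfig ι => ∀ a, q a → s' a = s a} :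
    PairIsing.gibbsAvg c (fun s =>
        (∑ s' ∈ Finset.univ.filter (fun s' : SpinConfig ι => ∀ a, q a → s' a = s a),
            g s' * PairIsing.gibbsWeight c s') /
          (∑ s' ∈ Finset.univ.filter (fun s' : SpinConfig ι => ∀ a, q a → s' a = s a),
            PairIsing.gibbsWeight c s')) =
      PairIsing.gibbsAvg c g := by
  rw [PairIsing.gibbsAvg_def, PairIsing.gibbsAvg_def]
  congr 1
  refine sum_classAvg_mul_eq_au (fun s => Finset.univ.filter fun s' : SpinConfig ι => ∀ a, q a → s' a = s a)
    (fun s => Finset.mem_filter.2 ⟨Finset.mem_univ _, fun _ _ => rfl⟩) (fun s s' hs' => ?_) _ g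
    (PairIsing.gibbsWeight_pos c)
  exact Finset.filter_congr fun t _ => forall₂_congr fun a ha => by rw [(Finset.mem_filter.1 hs').2 a ha]

/-! ## The stub -/

/-- **stub_replicaAllUpperUniform (S5au — the ALL-UPPER instance of the replica mirror, LOCALLY UNIFORM form).**
On configurations strictly ABOVE the plane every point is NEW: `replicaBox` is `⟨condLow L (∏ᵢ σ'_{[θwᵢ/δ]})⟩`,
and by the tower property of the exact conditional resampling `condLow` (`gibbsAvg_condLow_eq_au`) this is the
free-box bulk correlator `⟨∏ᵢ σ_{[θwᵢ/δ]}⟩^∅_{box L; β_c(3)}` = `twistCorr L 0 0 0 k [θw/δ] → criticalCorr 3 k [θw/δ]`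
(`tendsto_twistCorr_zero_right`), so `ρ^k replicaFold δ k w = rescaledCorrelator (criticalCorr 3) ρ k δ (θ ∘ w)`
for every `δ` on `NonCoincident 3 k ∩ {∀ i, 0 < h(wᵢ)}`. The datum converges locally uniformly on `NonCoincident`
(`HasPointwiseScalingLimit`); pulling back along the continuous injective `w ↦ θ ∘ w`
(`TendstoLocallyUniformlyOn.comp`) gives locally uniform convergence to `S k (θ ∘ w)`, and `S k (θ ∘ w) = S k w`
because EVERY limit datum with `S₂ > 0` is `O(3)`-invariant on `NonCoincident` (tree:
`MoebiusLimitExistsNegative.{normalised_hasLimit, normalised_nondeg, isTranslationInvariant_normalised_of_limit,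
exists_scaleCovariant_normalised}` + `limitRotationInvariant_proof ∘ HRP2Rigidity_of`).
[cite: AizenmanDuminilCopinSidoraviciusCMP2015, Thm. 1.2 with Cor. 1.5 (1)] [cite: FriedliVelenik2017, Exercise 3.16] -/
theorem stub_replicaAllUpperUniform :
    (fun (replicaFold : ℝ → (k : ℕ) → (Fin k → EuclideanSpace ℝ (Fin 3)) → ℝ) => ∀ (ρ : ℝ → ℝ) (S : CorrFamily 3), (∀ δ ∈ Set.Ioc (0:ℝ) 1, 0 < ρ δ) → HasPointwiseScalingLimit (criticalCorr 3) ρ S → IsNondegenerateTwoPoint S → ∀ (k : ℕ), TendstoLocallyUniformlyOn (fun (δ : ℝ) (w : Fin k → EuclideanSpace ℝ (Fin 3)) => ρ δ ^ k * replicaFold δ k w) (S k) (𝓝[>] (0:ℝ)) (NonCoincident 3 k ∩ {w | ∀ i, 0 < w i 0 + w i 1 + w i 2})) (fun (δ : ℝ) (k : ℕ) (w : Fin k → EuclideanSpace ℝ (Fin 3)) => Filter.limsup (fun L : ℕ => (fun (L k : ℕ) (old : Fin k → Prop) (z : Fin k → Site 3) => PairIsing.gibbsAvg (fun a b : ↥(box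 3 L) => if (∑ i, |a.1 i - b.1 i| = 1) then criticalBeta 3 / 2 else (0:ℝ)) (fun s => (∏ i, if old i then (if h : z i ∈ box 3 L then spinAt (⟨z i, h⟩ : ↥(box 3 L)) s else 0) else 1) * (fun (g : SpinConfig ↥(box 3 L) → ℝ) (s : SpinConfig ↥(box 3 L)) => (∑ s' ∈ Finset.univ.filter (fun s' : SpinConfig ↥(box 3 L) => ∀ a : ↥(box 3 L), ¬ (a.1 0 + a.1 1 + a.1 2 ≤ -1) → s' a = s a), g s' * PairIsing.gibbsWeight (fun a b : ↥(box 3 L) => if (∑ i, |a.1 i - b.1 i| = 1) then criticalBeta 3 / 2 else (0:ℝ)) s') / (∑ s' ∈ Finset.univ.filter (fun s' : SpinConfig ↥(box 3 L) => ∀ a : ↥(box 3 L), ¬ (a.1 0 + a.1 1 + a.1 2 ≤ -1) → s' a = s a), PairIsing.gibbsWeight (fun a b : ↥(box 3 L) => if (∑ i, |a.1 i - b.1 i| = 1) then criticalBeta 3 / 2 else (0:ℝ)) s')) (fun s' => ∏ i, if old i then 1 else (if h : z i ∈ box 3 L then spinAt (⟨z i, h⟩ : ↥(box 3 L)) s'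 else 0)) s)) L k (fun i => w i 0 + w i 1 + w i 2 ≤ 0) (fun i => latticeApprox δ ((fun v : EuclideanSpace ℝ (Fin 3) => if v 0 + v 1 + v 2 ≤ 0 then v else (fun v : EuclideanSpace ℝ (Fin 3) => ((ℝ ∙ (EuclideanSpace.single 0 1 + EuclideanSpace.single 1 1 + EuclideanSpace.single 2 1 : EuclideanSpace ℝ (Fin 3)))ᗮ).reflection v) v) (w i)))) Filter.atTop) := by
  intro ρ S hρ hlim hnd k
  -- `θ`-invariance of EVERY limit datum on non-coincident configurations (tree theorems), computed once per datum
  obtain ⟨Δ', -, hsc'⟩ :=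
    Summit.CriticalPhenomena.Ising3DConformalLimit.MoebiusLimitExistsNegative.exists_scaleCovariant_normalised hρ hlim hnd
  have hlim' := Summit.CriticalPhenomena.Ising3DConformalLimit.MoebiusLimitExistsNegative.normalised_hasLimit hlim
  have hnd' := Summit.CriticalPhenomena.Ising3DConformalLimit.MoebiusLimitExistsNegative.normalised_nondeg hnd
  have htr' :=
    Summit.CriticalPhenomena.Ising3DConformalLimit.MoebiusLimitExistsNegative.isTranslationInvariant_normalised_of_limit
      hlim
  have hnorm' : ∀ n z, z ∉ NonCoincident 3 n →
      (fun n x => if x ∈ NonCoincident 3 n then S n x else 0) n z = 0 := fun n z hz => if_neg hz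
  have hrot : IsRotationInvariant (fun n x => if x ∈ NonCoincident 3 n then S n x else 0) :=
    Summit.CriticalPhenomena.Ising3DConformalLimit.Cruxes.LimitRotationInvariant.QuarterTurnLiouville.limitRotationInvariant_proof
      Summit.CriticalPhenomena.Ising3DConformalLimit.Cruxes.HRP2Rigidity.XRayMellin.HRP2Rigidity_of
      ρ Δ' _ hρ hlim' hnorm' hnd' htr' hsc'
  -- the reflected configuration map `w ↦ θ ∘ w` sends the set into `NonCoincident` (`θ` is injective) …
  have hmaps : MapsTo
      (fun (w : Fin k → EuclideanSpace ℝ (Fin 3)) (i : Fin k) =>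
        ((ℝ ∙ (EuclideanSpace.single 0 1 + EuclideanSpace.single 1 1 + EuclideanSpace.single 2 1 : EuclideanSpace ℝ (Fin 3)))ᗮ.reflection) (w i))
      (NonCoincident 3 k ∩ {w | ∀ i, 0 < w i 0 + w i 1 + w i 2}) (NonCoincident 3 k) := by
    intro w hw
    rw [mem_nonCoincident]
    intro i j hij
    exact (mem_nonCoincident _).1 hw.1
      (((ℝ ∙ (EuclideanSpace.single 0 1 + EuclideanSpace.single 1 1 + EuclideanSpace.single 2 1 : EuclideanSpace ℝ (Fin 3)))ᗮ.reflection).injective hij)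
  -- … and is continuous
  have hcont : ContinuousOn
      (fun (w : Fin k → EuclideanSpace ℝ (Fin 3)) (i : Fin k) =>
        ((ℝ ∙ (EuclideanSpace.single 0 1 + EuclideanSpace.single 1 1 + EuclideanSpace.single 2 1 : EuclideanSpace ℝ (Fin 3)))ᗮ.reflection) (w i))
      (NonCoincident 3 k ∩ {w | ∀ i, 0 < w i 0 + w i 1 + w i 2}) :=
    (continuous_pi fun i =>
      ((ℝ ∙ (EuclideanSpace.single 0 1 + EuclideanSpace.single 1 1 + EuclideanSpace.single 2 1 : EuclideanSpace ℝ (Fin 3)))ᗮ.reflection).continuous.comp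
        (continuous_apply i)).continuousOn
  -- pull the datum's locally uniform convergence back along `w ↦ θ ∘ w`, then identify both sides on the set
  refine (((hlim k).comp _ hmaps hcont).congr fun δ w hw => ?_).congr_right fun w hw => ?_
  · -- pointwise in `δ`: `rescaledCorrelator (criticalCorr 3) ρ k δ (θ ∘ w) = ρ δ ^ k * replicaFold δ k w`
    have hnle : ∀ i, ¬ (w i 0 + w i 1 + w i 2 ≤ 0) := fun i => not_le.2 (hw.2 i)
    show rescaledCorrelator (criticalCorr 3) ρ k δ (fun i =>
      ((ℝ ∙ (EuclideanSpace.single 0 1 + EuclideanSpace.single 1 1 + EuclideanSpace.single 2 1 : EuclideanSpace ℝ (Fin 3)))ᗮ.reflection) (w i)) = _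
    rw [rescaledCorrelator_apply]
    congr 1
    -- the `limsup` over boxes is the box limit `criticalCorr 3 k [θ w/δ]` of the bulk correlator
    refine (Filter.Tendsto.limsup_eq ?_).symm
    refine (tendsto_twistCorr_zero_right 0 k _ 0).congr fun L => ?_
    -- all points are NEW: the fold is `θ`, the OLD monomial is `1`
    simp only [hnle, if_false, Finset.prod_const_one, one_mul]
    rw [← gibbsAvg_nn_eq_twistCorr_au]
    -- tower property of the conditional resampling
    exact (gibbsAvg_condLow_eq_au _ _ _).symm
  · -- `S k (θ ∘ w) = S k w`
    have h := hrot k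
      ((ℝ ∙ (EuclideanSpace.single 0 1 + EuclideanSpace.single 1 1 + EuclideanSpace.single 2 1 : EuclideanSpace ℝ (Fin 3)))ᗮ.reflection) w
    dsimp only at h
    rw [if_pos hw.1, if_pos (hmaps hw)] at h
    exact h

end Summit.CriticalPhenomena.Ising3DConformalLimit.Cruxes.TwinTransparency.ReplicaMirror

end
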